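import Summits.CriticalPhenomena.PercolationContinuityZ3.Theorems.SahiMasterFamilyCommonPivotalNoCoreFree
import Summits.CriticalPhenomena.PercolationContinuityZ3.Theorems.SahiMasterFamilyStructZeroFlag
import Summits.CriticalPhenomena.PercolationContinuityZ3.Theorems.SahiMasterFamilyPCDPositive
import Summits.CriticalPhenomena.PercolationContinuityZ3.Theorems.SahiMasterFamilyTerminalTightFour

/-!
# Tightness of common-pivotal face-vanishing triples without an absorbing member

Unit `prim-masterthm-p4` (gen 12; crux anchor stmt-CriticalPhenomena-4575, helper work; memo
`run/shared/lean/prim/prim-masterthm/prim-masterthm-p4/P4-GEN12-REPORT.md`).  Continues `…CommonPivotalNoCoreFree`.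

The glued-frame argument lives on the FULL coordinate set (every coordinate a face coordinate), while the tightness / positivity
statements of the (P3+) reduction (`FaceVanishingCommonPivotalTight`, `SahiE3PositiveOfCommonPivotalFaceVanishing`) speak of events on
any finite `ι` determined by a finset `S`.  This file restricts events determined by `S` to events on the subtype `↥S` (prim-master-conj's `GluedFrames.pull`, which
preserves increasing-ness, non-emptiness, sections, pivotality, inclusions and the zero-flag class), translates the zero-flag hypothesis on
faces into structured faces (`structured_of_suppZeroFlag`), and proves

  **`principalCap_of_commonPivotal_noAbsorber`**: three increasing events determined by `S`, with a common pivotal coordinate, all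
  minors at coordinates of `S` in `Z_3`, and NO member containing the other two, have principal common part `{T | ↑S ⊆ T}`.

This is the no-absorber case of `PositiveSomewhere.FaceVanishingCommonPivotalTight` (gen 11).  Axioms standard. [this work]
-/

noncomputable section

open scoped Classical

namespace Summit.CriticalPhenomena.PercolationContinuityZ3.Theorems

namespace PositiveSomewhere

open Finset Function GluedFrames
open Literature.Probability.Percolation (DeterminedBy determinedBy_iff)
open Literature.Probability.LatticeModels.Kahn2022 (Affects)



/-! ### The no-absorber case of tightness -/

/-- **Principal cap for common-pivotal face-vanishing triples with no absorbing member.**  Three increasing events determined by `S`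
with a coordinate pivotal for all three, all of whose minors at coordinates of `S` are zero flags, and such that no member contains the
other two, have principal common part `{T | ↑S ⊆ T}` — i.e. every coordinate of `S` lies in the core of some member.  Proof: restrict to
`↥S`; there the contraction faces and the deletion faces at core-free coordinates are structured (`structured_of_suppZeroFlag`), so
`eq_univ_of_mem_cap_of_commonPivotal` applies. [this work] -/
theorem principalCap_of_commonPivotal_noAbsorber (ι : Type) [Fintype ι] (U : Fin 3 → Set (Set ι)) (S : Finset ι)
    (hU : ∀ j, IsUpperSet (U j)) (hUS : ∀ j, DeterminedBy (U j) (↑S : Set ι))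
    (hpiv : ∃ e : ι, ∀ j, ∃ ω, e ∉ ω ∧ ω ∉ U j ∧ insert e ω ∈ U j)
    (hfv : ∀ e ∈ S, ∀ b : Bool, SuppZeroFlag 3 (fun j => secAt e b (U j)))
    (hnabs : ∀ l, ∃ m, m ≠ l ∧ ¬ U m ⊆ U l) :
    ∀ T : Set ι, (∀ j, T ∈ U j) ↔ (↑S : Set ι) ⊆ T := by
  obtain ⟨e, he⟩ := hpiv
  have hne : ∀ j, (U j).Nonempty := fun j => by obtain ⟨ω, -, -, h⟩ := he j; exact ⟨_, h⟩
  have h0 : ∀ j, (∅ : Set ι) ∉ U j := fun j => empty_notMem_of_pivotal (U j) (hU j) (he j)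
  have heS : e ∈ S := by
    obtain ⟨ω, -, hω, hωe⟩ := he 0
    exact esupp_subset_of_determinedBy (hUS 0) (mem_esupp.2 ⟨ω, hω, hωe⟩)
  -- the restricted family on `↥S`
  set U' : Fin 3 → Set (Set ↥S) := fun j => pull S (U j) with hU'def
  have hU' : ∀ j, IsUpperSet (U' j) := fun j => isUpperSet_pull S (hU j)
  have hne' : ∀ j, (U' j).Nonempty := fun j => pull_nonempty S (hUS j) (hne j)
  have hns' : ∀ j, U' j ≠ Set.univ := fun j h =>
    empty_not_mem_pull S (h0 j) (show (∅ : Set ↥S) ∈ U' j from by rw [h]; exact Set.mem_univ _)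
  have hWU : ∀ k : Fin 3, k ∈ (univ : Finset (Fin 3)) := mem_univ
  have hcard : (univ : Finset (Fin 3)).card = 3 := by simp
  -- faces of the restricted family are structured
  have hface : ∀ (h : ↥S) (b : Bool), (∀ j, (secAt h b (U' j)).Nonempty) →
      Structured (fun j => secAt h b (U' j)) (univ : Finset (Fin 3)) := by
    intro h b hneF
    have hZ : SuppZeroFlag 3 (fun j => secAt h b (U' j)) := by
      have := suppZeroFlag_pull S 3 _ (hfv h h.2 b)
      convert this using 1
      funext j
      exact (pull_secAt S (U j) h b).symm
    have hupF : ∀ j, IsUpperSet (secAt h b (U' j)) := fun j => isUpperSet_secAt h b (hU' j)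
    have := structured_of_suppZeroFlag 1 (fun j => secAt h b (U' j)) hupF hneF id injective_id hZ
    simpa using this
  have hS : ∀ h : ↥S, Structured (faceT U' h) univ := fun h => hface h true (faceT_nonempty U' hU' hne' h)
  have hF : ∀ f : ↥S, CoreFree U' f → Structured (faceF U' f) univ := fun f hf => hface f false (faceF_nonempty U' hf)
  have habs' : ∀ l ∈ (univ : Finset (Fin 3)), ∃ m ∈ (univ : Finset (Fin 3)), m ≠ l ∧ ¬ U' m ⊆ U' l := by
    intro l _
    obtain ⟨m, hml, hnot⟩ := hnabs l
    exact ⟨m, mem_univ m, hml, fun h => hnot (subset_of_pull_subset S (hUS m) (hUS l) h)⟩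
  have hx' : ∃ x : ↥S, ∀ k, Affects (U' k) x := by
    refine ⟨⟨e, heS⟩, fun k => (affects_pull_iff S (hUS k) ⟨e, heS⟩).2 ?_⟩
    obtain ⟨ω, -, hω, hωe⟩ := he k
    exact ⟨ω, hω, hωe⟩
  have hcap : ∀ T' : Set ↥S, (∀ k, T' ∈ U' k) → T' = Set.univ := fun T' hT' =>
    eq_univ_of_mem_cap_of_commonPivotal U' univ hU' hne' hns' hWU hcard hS habs' hx' hF hT'
  -- transfer back to `ι`
  intro T
  constructor
  · intro hT
    have h' : ∀ j, (Subtype.val : ↥S → ι) ⁻¹' T ∈ U' j := fun j => (mem_iff_preimage_mem_pull S (hUS j) T).1 (hT j)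
    have huniv := hcap _ h'
    intro y hy
    have : (⟨y, hy⟩ : ↥S) ∈ (Subtype.val : ↥S → ι) ⁻¹' T := by rw [huniv]; exact Set.mem_univ _
    exact this
  · intro h j
    have huniv : Set.univ ∈ U j := univ_mem_of_nonempty (hU j) (hne j)
    refine ((determinedBy_iff (U j) ↑S).1 (hUS j) T Set.univ ?_).2 huniv
    rw [Set.univ_inter, Set.inter_eq_right.2 h]

end PositiveSomewhere

end Summit.CriticalPhenomena.PercolationContinuityZ3.Theorems
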